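import Summits.NavierStokesRegularity.NavierStokesRegularity.Theorems.ExtremiserTransienceNearExtremalTransiencePerFlowOfSparseEfficientTimes
import Summits.NavierStokesRegularity.NavierStokesRegularity.Theorems.ExtremiserTransienceSparseAnalyticTransfer
import Summits.NavierStokesRegularity.NavierStokesRegularity.Theorems.ExtremiserTransiencePlateauSobolevCost
import Literature.Analysis.PDE.AnalyticPropagationOfSmallness
import HarnessLib

/-!
# Route `ExtremiserTransience`, crux `NearExtremalTransiencePerFlow` (stmt-NavierStokesRegularity-26567),
# LINE g8-β «analytic gap»: THE GAP AND THE CRUX FROM THE PLATEAU SPREAD (P-R's conclusion) AND THE OPEN HEART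

`--supports stmt-NavierStokesRegularity-26567` (helper). Author: prover seat `ns-net-p2` (g2).

With S-B (`SparseBangBang.sparseNearPlateauStability`, this seat), P-C (`plateauSobolevCost`, seat ns-net-p1) and S-A
(`sparseAnalyticTransfer`, seat ns-net-p1) landed, LINE g8-β of `Cruxes/NearExtremalTransiencePerFlow/Lines/analytic_gap.lean`
reduces to its Literature fact P-F and the open heart S-E.  This file records, BY NAME over the texts of record
(`…AnalyticGapDefs`, `…SparseBangBangDefs`):
* `analyticPropagationOfSmallness_of_literature` — the workfile's P-F `AnalyticPropagationOfSmallness` IS the tree's named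
  fact `Literature.Analysis.PDE.analyticPropagationOfSmallness 3` (Apraiz–Escauriaza–Wang–Zhang 2014 Thm 4 / Vessella 1999;
  definitional match);
* `sparseAnalyticGap_of_plateauSpread` — G `SparseAnalyticGap` from the plateau spread `AnalyticPlateauSpread` (P-R's
  conclusion) alone (the workfile's `sparseAnalyticGap_of` with S-B and P-C discharged);
* `nearExtremalTransiencePerFlow_of_plateauSpread` — the crux (26567, BY NAME) from `AnalyticPlateauSpread` and S-E
  (`SparseEfficientTimes`), via S-A and G.
So once P-R `AnalyticPropagationOfSmallness → AnalyticPlateauSpread` lands, the crux follows from the NAMED FACT and S-E.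
HONEST FRAMING: conditional reductions between OPEN/cited statements about one functional and hypothetical violator flows;
nothing about Navier–Stokes regularity is proved; 26567 and the summit remain OPEN; no summit is proved by a line. [folklore]
-/

noncomputable section

open scoped Topology InnerProductSpace RealInnerProductSpace ENNReal ContDiff
open MeasureTheory Filter Set Metric
open Summit.NavierStokesRegularity.NavierStokesRegularity.Theses.ExtremiserTransience
open Summit.NavierStokesRegularity.NavierStokesRegularity.Theorems.DepletionLadder.KStar
open Summit.NavierStokesRegularity.NavierStokesRegularity.Theorems.DepletionLadder.KStar.HalfSpace
open Summit.NavierStokesRegularity.NavierStokesRegularity.Theorems.DepletionLadder.KStar.BangBang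
open Summit.NavierStokesRegularity.NavierStokesRegularity.Theorems.NearExtremalTransiencePerFlow.SparseBangBang
  (IsSparse SparseEfficientTimes SparseNearPlateauStability)

namespace Summit.NavierStokesRegularity.NavierStokesRegularity.Theorems

-- the problem directory repeats the summit name (`NavierStokesRegularity/NavierStokesRegularity`)
set_option linter.dupNamespace false

namespace NearExtremalTransiencePerFlow.AnalyticGap

/-- **P-F is the tree's named fact**: `Literature.Analysis.PDE.analyticPropagationOfSmallness 3 → AnalyticPropagationOfSmallness`
(definitional). [cite: ApraizEscauriazaWangZhang2014, Theorem 4] -/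
theorem analyticPropagationOfSmallness_of_literature (h : Literature.Analysis.PDE.analyticPropagationOfSmallness 3) :
    AnalyticPropagationOfSmallness := h

/-- Positivity unpacking of the non-degeneracy hypothesis `0 < M·√Z·√W`. [folklore] -/
theorem pos_unpack {v : E3 → E3} {M : ℝ} (hpos : 0 < M * Real.sqrt (Zen v) * Real.sqrt (Wpa v)) :
    0 < M ∧ 0 < Zen v ∧ 0 < Wpa v ∧ 0 < lam v := by
  have hW' : 0 < Real.sqrt (Wpa v) := by
    rcases (Real.sqrt_nonneg (Wpa v)).eq_or_lt with h | h
    · rw [← h, mul_zero] at hpos; exact absurd hpos (lt_irrefl 0)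
    · exact h
  have h1 : 0 < M * Real.sqrt (Zen v) := (mul_pos_iff_of_pos_right hW').1 hpos
  have hZ' : 0 < Real.sqrt (Zen v) := by
    rcases (Real.sqrt_nonneg (Zen v)).eq_or_lt with h | h
    · rw [← h, mul_zero] at h1; exact absurd h1 (lt_irrefl 0)
    · exact h
  have hM : 0 < M := (mul_pos_iff_of_pos_right hZ').1 h1
  have hZ : 0 < Zen v := Real.sqrt_pos.1 hZ'
  have hW : 0 < Wpa v := Real.sqrt_pos.1 hW'
  refine ⟨hM, hZ, hW, ?_⟩
  unfold lam
  exact Real.sqrt_pos.2 (div_pos hZ hW)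

/-- `Z = λ²·W` for a non-degenerate field. [folklore] -/
theorem zen_eq_lam_sq_mul {v : E3 → E3} (hZ : 0 < Zen v) (hW : 0 < Wpa v) : Zen v = lam v ^ 2 * Wpa v := by
  unfold lam
  rw [Real.sq_sqrt (div_nonneg hZ.le hW.le)]
  field_simp

/-- **G from the plateau spread alone** (the workfile's `sparseAnalyticGap_of` with S-B := `sparseNearPlateauStability` and
P-C := `plateauSobolevCost` discharged): `AnalyticPlateauSpread → SparseAnalyticGap`. [folklore] -/
theorem sparseAnalyticGap_of_plateauSpread (hR : AnalyticPlateauSpread) : SparseAnalyticGap := by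
  intro ρ hρ hρ1 N₀ hN₀
  obtain ⟨c, hc, hcost⟩ := plateauSobolevCost
  obtain ⟨c₀, r, hc₀, hr, hδ⟩ := SparseBangBang.sparseNearPlateauStability (facBudget ρ) (one_le_facBudget hρ hρ1) N₀ hN₀
  set R : ℝ := (N₀ + 1) / c with hRdef
  have hRpos : 0 < R := div_pos (by linarith) hc
  have hcR : c * R = N₀ + 1 := by rw [hRdef]; field_simp
  obtain ⟨δ, hδpos, hspread⟩ := hR ρ r c₀ R (1 / 2) hρ hr hc₀ hRpos (by norm_num)
  obtain ⟨ε, hε, hfat⟩ := hδ δ hδpos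
  refine ⟨ε, hε, ?_⟩
  intro v M B hadm han hsp hpos
  by_contra hlt
  push Not at hlt
  obtain ⟨hM, hZ, hW, hlam⟩ := pos_unpack hpos
  obtain ⟨x₀, hvol⟩ := hfat v M B hadm (isReg_of_isAnalyticReg han) hsp hpos hlt.le
  have hplateau := hspread v M x₀ hM hadm.1 hadm.2.2.1 han hlam hvol
  have hcostv : c * (R * lam v) * M ^ 2 ≤ Zen v :=
    hcost v M B R x₀ hadm hM hRpos hlam (fun x hx => by have := hplateau x hx; linarith)
  have hZeq := zen_eq_lam_sq_mul hZ hW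
  have h2 : lam v * (c * R * M ^ 2) ≤ lam v * (N₀ * M ^ 2) := by
    have h3 : Zen v ≤ lam v * (N₀ * M ^ 2) := by
      calc Zen v = lam v * (Wpa v * lam v) := by rw [hZeq]; ring
        _ ≤ lam v * (N₀ * M ^ 2) := mul_le_mul_of_nonneg_left hsp hlam.le
    have h4 : lam v * (c * R * M ^ 2) = c * (R * lam v) * M ^ 2 := by ring
    linarith [hcostv, h3, h4]
  have key : c * R * M ^ 2 ≤ N₀ * M ^ 2 := le_of_mul_le_mul_left h2 hlam
  rw [hcR] at key
  nlinarith [hM, key]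

/-- **The crux from the plateau spread and the open heart**: `AnalyticPlateauSpread → SparseEfficientTimes →
NearExtremalTransiencePerFlow` (26567 BY NAME), via S-A `sparseAnalyticTransfer` and G. [folklore] -/
theorem nearExtremalTransiencePerFlow_of_plateauSpread (hR : AnalyticPlateauSpread) (hE : SparseEfficientTimes) :
    Summit.NavierStokesRegularity.NavierStokesRegularity.Theses.ExtremiserTransience.NearExtremalTransiencePerFlow := by
  intro C ν T hC hν hT0 u p hsol hLH hdec hrate hne
  by_contra hno
  obtain ⟨ρ, N₀, hρ, hρ1, hN₀, hall⟩ := sparseAnalyticTransfer hE C ν T u p ⟨hC, hν, hT0, hsol, hLH, hdec, hrate, hne, hno⟩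
  obtain ⟨ε, hε, hgap⟩ := sparseAnalyticGap_of_plateauSpread hR ρ hρ hρ1 N₀ hN₀
  obtain ⟨t, M, B, ht, hadm, han, hsp, hpos, heff⟩ := hall (ε / 2) (half_pos hε)
  have h := hgap (u t) M B hadm han hsp hpos
  nlinarith [mul_pos hε hpos, heff, h]

/-- **The crux from the NAMED FACT, P-R and the open heart** — the line's final shape once P-R lands:
`analyticPropagationOfSmallness 3 → (P-F → P-R's spread) → SparseEfficientTimes → NearExtremalTransiencePerFlow`. [folklore] -/
theorem nearExtremalTransiencePerFlow_of_fact (hF : Literature.Analysis.PDE.analyticPropagationOfSmallness 3)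
    (hR : AnalyticPropagationOfSmallness → AnalyticPlateauSpread) (hE : SparseEfficientTimes) :
    Summit.NavierStokesRegularity.NavierStokesRegularity.Theses.ExtremiserTransience.NearExtremalTransiencePerFlow :=
  nearExtremalTransiencePerFlow_of_plateauSpread (hR (analyticPropagationOfSmallness_of_literature hF)) hE

end NearExtremalTransiencePerFlow.AnalyticGap

end Summit.NavierStokesRegularity.NavierStokesRegularity.Theorems

end
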